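import Mathlib
import Literature.MathematicalPhysics.QuantumFieldTheory.Luscher2010.TrivializingMaps
import Literature.MathematicalPhysics.QuantumFieldTheory.Luscher2010.FlowExistenceProofs
import Summits.Ventures.LatticeQCDFlow.TrivializingMaps.TruncationDefect
import Summits.Ventures.LatticeQCDFlow.TrivializingMaps.DefectLogWeight
import Summits.Ventures.LatticeQCDFlow.TrivializingMaps.DefectLogWeightMeasure
import Summits.Ventures.LatticeQCDFlow.TrivializingMaps.TrivializingFlow

/-!
# Lüscher's trivializing-flow criterion (§4.1, eqs. (4.1)–(4.3)) for a GENERAL tangent generator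

HONEST FRAMING: exact (Metropolis-corrected) sampling algorithms for lattice gauge theory; figures of merit are
autocorrelation/cost numbers at stated couplings and volumes; no continuum-physics claim.

Lüscher §4.1: "it suffices to find a generator `Z_t(U)` that satisfies eq. (4.3)",
`∑_{x,μ} {∂^a_{x,μ} [Z_t(U)]^a(x,μ) - t ∂^a_{x,μ}S(U) · [Z_t(U)]^a(x,μ)} = S(U) + Ċ_t` — "the differential
condition (4.3) and the flow equation (3.2) imply eq. (4.1)", `ln det 𝓕_{t*}(V) = t S(𝓕_t(V)) + C_t`, "and
the transformation at `t = 1` is then a trivializing map".  File A (`Luscher2010/TrivializingMaps.lean`)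
records this as the cited `Prop` `TrivializingFlowCriterion d L n`, for an ARBITRARY `C¹` tangent generator
`Z` (not only the gradient ansatz `Z_t = -∂S̃_t` of (4.4), which is the case treated by
`TrivializingFlow.lean`).  This file PROVES it, modulo the Jacobian formula (3.9) which enters exactly once:

* `suBasis_eq_sum_coord_smul`: `X = ∑_a X^a T^a` on `𝔰𝔲(n)` with Lüscher's coordinates `X^a = -2 Re tr(T^a X)`;
* `hasDerivAt_comp_flowMap` — **chain rule along a flow line of a tangent generator**:
  `d/dt S(𝓕_t V) = ∑_{x,μ,a} ∂^a_{x,μ}S(𝓕_t V) · [Z_t(𝓕_t V)]^a(x,μ)` for `C¹` `S` (the term multiplying `t`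
  in (4.3));
* `integral_linkDiv_flowMap_eq` — **(4.3) + (3.2) ⇒ (4.1)**: `∫₀ᵗ div Z_s(𝓕_s V) ds = t S(𝓕_t V) + ∫₀ᵗ Ċ`;
* `trivializingFlowCriterion_of : JacobianFormula d L n → TrivializingFlowCriterion d L n` — with (3.9) at
  `t = 1` the pulled-back weight is `e^{-S(𝓕_1 V)} det 𝓕_{1*}(V) = e^{C_1}`, a constant, so
  `(𝓕_1)_* D[V] = 𝒵⁻¹ e^{-S} D[U]` (`IsTrivializingMap`, transport form (2.9)); global existence / joint
  continuity of the flow (§3.1) is the tree THEOREM `Luscher2010.flowGlobalExistence_holds`, used for the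
  measurability of `𝓕_1`.

`JacobianFormula d L n` (eq. (3.9)) is the only remaining hypothesis; when its proof lands in the tree the
unconditional `TrivializingFlowCriterion d L n` is a one-line corollary.  OUR formalisation (venture
placement); the cited statement stays in the Literature file.  Reuses theory-1's link calculus
(`linkDeriv_eq_fderiv`, `fderiv_apply_sum_smul_mul`, `isFlowLine_hasDerivAt_amb`) and measure packaging
(`isFlowMap_continuous_unique`, `map_trivialMeasure_eq_withDensity`, `withDensity_exp_neg_add_eq_boltzmann`,
`map_eq_boltzmann_of_density_le`).

References: M. Lüscher, Trivializing maps, the Wilson flow and the HMC algorithm, CMP 293 (2010) 899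
[Luscher2010Trivializing, arXiv:0907.5491], §2.3 eq. (2.9), §3.1 eq. (3.2), §3.2 eq. (3.9), §4.1 eqs. (4.1)–(4.3),
App. A eqs. (A.3), (A.10).
-/

namespace Summit.Ventures.LatticeQCDFlow.TrivializingMaps

open MeasureTheory
open Literature.MathematicalPhysics.QuantumFieldTheory
open Literature.MathematicalPhysics.QuantumFieldTheory.Luscher2010
open scoped Matrix Matrix.Norms.Frobenius ContDiff BoundedContinuousFunction

variable {d L n : ℕ}

/-! ## §1. Lie-algebra coordinates and the chain rule along flow lines of a tangent generator -/

section ChainRule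

/-- **Coordinates in an `𝔰𝔲(n)` basis**: `X = ∑_a X^a T^a` with `X^a = -2 Re tr(T^a X)` for `X ∈ 𝔰𝔲(n)`
(App. A eq. (A.10); the completeness field `SuBasis.span` read through `SuBasis.coord`).
[cite: Luscher2010Trivializing, App. A eqs. (A.5), (A.10)] -/
theorem suBasis_eq_sum_coord_smul (B : SuBasis n) {X : Matrix (Fin n) (Fin n) ℂ} (hX : X ∈ suAlgebra n) :
    X = ∑ a, ((B.coord a X : ℝ) : ℂ) • B.T a := by
  obtain ⟨c, hc⟩ := B.span X hX
  have hca : ∀ a, B.coord a X = c a := fun a => by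
    rw [hc]
    exact suBasis_coord_sum_smul B c a
  simp_rw [hca]
  exact hc

variable [NeZero L]

omit [NeZero L] in
/-- The right-hand side `Z_t(U) U` of the flow equation at a point of the field manifold, expanded in the
basis: `Z_t(U)(e) U(e) = (∑_a [Z_t(U)]^a(e) T^a) U(e)` (tangency). [cite: Luscher2010Trivializing, §3.1 eqs. (3.1)–(3.2)] -/
theorem flowField_eq_sum_coord (B : SuBasis n) {Z : Generator d L n} (hZt : Z.IsTangent) (t : ℝ)
    (U : GaugeConfig d L (Matrix.specialUnitaryGroup (Fin n) ℂ)) :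
    (fun e => Z t (WilsonFlow.coeConfig U) e * WilsonFlow.coeConfig U e) =
      fun e => (∑ a, ((B.coord a (Z t (WilsonFlow.coeConfig U) e) : ℝ) : ℂ) • B.T a) *
        WilsonFlow.coeConfig U e := by
  funext e
  rw [← suBasis_eq_sum_coord_smul B (hZt t U e)]

/-- **Chain rule along a flow line of a tangent generator** (the `t`-term of (4.3)): for `C¹` `S` and an
integrated transformation `𝓕` of `Z`, `d/dt S(𝓕_t V) = ∑_{x,μ,a} ∂^a_{x,μ} S(𝓕_t V) · [Z_t(𝓕_t V)]^a(x,μ)`.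
[cite: Luscher2010Trivializing, §4.1 (derivation of (4.1) from (4.3)), App. A eq. (A.3)] -/
theorem hasDerivAt_comp_flowMap (B : SuBasis n) {S : AmbConfig d L n → ℝ} (hS : ContDiff ℝ 1 S)
    {Z : Generator d L n} (hZt : Z.IsTangent)
    {Φ : ℝ → GaugeConfig d L (Matrix.specialUnitaryGroup (Fin n) ℂ) →
      GaugeConfig d L (Matrix.specialUnitaryGroup (Fin n) ℂ)} (hΦ : IsFlowMap Z Φ)
    (V : GaugeConfig d L (Matrix.specialUnitaryGroup (Fin n) ℂ)) (t : ℝ) :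
    HasDerivAt (fun s => S (WilsonFlow.coeConfig (Φ s V)))
      (∑ e, ∑ a, linkDeriv e (B.T a) S (WilsonFlow.coeConfig (Φ t V)) *
        B.coord a (Z t (WilsonFlow.coeConfig (Φ t V)) e)) t := by
  have h1 : HasDerivAt (fun s => WilsonFlow.coeConfig (Φ s V))
      (fun e => Z t (WilsonFlow.coeConfig (Φ t V)) e * WilsonFlow.coeConfig (Φ t V) e) t :=
    isFlowLine_hasDerivAt_amb (hΦ.2 V) t
  have hSd : DifferentiableAt ℝ S (WilsonFlow.coeConfig (Φ t V)) := (hS.differentiable one_ne_zero) _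
  have h2 := hSd.hasFDerivAt.comp_hasDerivAt t h1
  refine h2.congr_deriv ?_
  rw [flowField_eq_sum_coord B hZt t (Φ t V)]
  exact (fderiv_apply_sum_smul_mul B hSd fun e a => B.coord a (Z t (WilsonFlow.coeConfig (Φ t V)) e)).trans
    (Finset.sum_congr rfl fun e _ => Finset.sum_congr rfl fun a _ => mul_comm _ _)

/-- The `t`-coefficient of (4.3), `∑ ∂^a S · Z^a_t`, is continuous along a flow line (for `C¹` data).
[folklore] -/
theorem continuous_sum_linkDeriv_mul_coord_flowMap (B : SuBasis n) {S : AmbConfig d L n → ℝ}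
    (hS : ContDiff ℝ 1 S) {Z : Generator d L n} (hZ : ContDiff ℝ 1 fun p : ℝ × AmbConfig d L n => Z p.1 p.2)
    {Φ : ℝ → GaugeConfig d L (Matrix.specialUnitaryGroup (Fin n) ℂ) →
      GaugeConfig d L (Matrix.specialUnitaryGroup (Fin n) ℂ)} (hΦ : IsFlowMap Z Φ)
    (V : GaugeConfig d L (Matrix.specialUnitaryGroup (Fin n) ℂ)) :
    Continuous fun s : ℝ => ∑ e, ∑ a, linkDeriv e (B.T a) S (WilsonFlow.coeConfig (Φ s V)) *
      B.coord a (Z s (WilsonFlow.coeConfig (Φ s V)) e) := by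
  have hUc : Continuous fun s => WilsonFlow.coeConfig (Φ s V) :=
    continuous_iff_continuousAt.2 fun s => (isFlowLine_hasDerivAt_amb (hΦ.2 V) s).continuousAt
  have hpair : Continuous fun s : ℝ => (s, WilsonFlow.coeConfig (Φ s V)) := continuous_id.prodMk hUc
  refine continuous_finsetSum _ fun e _ => continuous_finsetSum _ fun a _ => ?_
  refine Continuous.mul ?_ ?_
  · -- `s ↦ ∂_{e,T^a} S(U_s) = DS(U_s)[δ_e T^a U_s(e)]`
    have heq : (fun s => linkDeriv e (B.T a) S (WilsonFlow.coeConfig (Φ s V))) = fun s =>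
        fderiv ℝ S (WilsonFlow.coeConfig (Φ s V))
          (Pi.single e (B.T a * WilsonFlow.coeConfig (Φ s V) e)) :=
      funext fun s => linkDeriv_eq_fderiv ((hS.differentiable one_ne_zero) _) e (B.T a)
    rw [heq]
    refine ((hS.continuous_fderiv one_ne_zero).comp hUc).clm_apply ?_
    exact (contDiff_pi_single_mul_apply e (B.T a)).continuous.comp hUc
  · -- `s ↦ [Z_s(U_s)]^a(e) = -2 Re tr(T^a Z_s(U_s)(e))`
    unfold SuBasis.coord
    have hZe : Continuous fun s => Z s (WilsonFlow.coeConfig (Φ s V)) e :=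
      (continuous_apply e).comp (hZ.continuous.comp hpair)
    refine continuous_const.mul (Complex.continuous_re.comp ?_)
    exact (continuous_const.mul hZe).matrix_trace

end ChainRule

/-! ## §2. (4.3) + (3.2) ⇒ (4.1): the log-Jacobian along the flow -/

section Criterion

variable [NeZero L]

/-- **The differential condition (4.3) and the flow equation (3.2) imply (4.1)**: if `Z` satisfies
`div Z_t - t (∂S · Z_t) = S + Ċ_t` on the field manifold, then along every flow line
`∫₀ᵗ div Z_s(𝓕_s V) ds = t S(𝓕_t V) + ∫₀ᵗ Ċ_s ds` — i.e. with (3.9), `ln det 𝓕_{t*}(V) = t S(𝓕_t V) + C_t`.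
[cite: Luscher2010Trivializing, §4.1 eqs. (4.1)–(4.3)] -/
theorem integral_linkDiv_flowMap_eq (B : SuBasis n) {S : AmbConfig d L n → ℝ} (hS : ContDiff ℝ 1 S)
    {Z : Generator d L n} (hZ : ContDiff ℝ 1 fun p : ℝ × AmbConfig d L n => Z p.1 p.2) (hZt : Z.IsTangent)
    {Φ : ℝ → GaugeConfig d L (Matrix.specialUnitaryGroup (Fin n) ℂ) →
      GaugeConfig d L (Matrix.specialUnitaryGroup (Fin n) ℂ)} (hΦ : IsFlowMap Z Φ)
    {C' : ℝ → ℝ} (hC' : Continuous C')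
    (hcrit : ∀ (t : ℝ) (U : GaugeConfig d L (Matrix.specialUnitaryGroup (Fin n) ℂ)),
      linkDiv B (Z t) (WilsonFlow.coeConfig U)
        - t * ∑ e : Edge d L, ∑ a : B.ι, linkDeriv e (B.T a) S (WilsonFlow.coeConfig U)
            * B.coord a (Z t (WilsonFlow.coeConfig U) e)
        = S (WilsonFlow.coeConfig U) + C' t)
    (V : GaugeConfig d L (Matrix.specialUnitaryGroup (Fin n) ℂ)) (t : ℝ) :
    ∫ s in (0 : ℝ)..t, linkDiv B (Z s) (WilsonFlow.coeConfig (Φ s V)) =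
      t * S (WilsonFlow.coeConfig (Φ t V)) + ∫ s in (0 : ℝ)..t, C' s := by
  set D : ℝ → ℝ := fun s => ∑ e, ∑ a, linkDeriv e (B.T a) S (WilsonFlow.coeConfig (Φ s V)) *
    B.coord a (Z s (WilsonFlow.coeConfig (Φ s V)) e) with hD
  have hUc : Continuous fun s => WilsonFlow.coeConfig (Φ s V) :=
    continuous_iff_continuousAt.2 fun s => (isFlowLine_hasDerivAt_amb (hΦ.2 V) s).continuousAt
  have hcS : Continuous fun s => S (WilsonFlow.coeConfig (Φ s V)) := hS.continuous.comp hUc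
  have hcD : Continuous D := continuous_sum_linkDeriv_mul_coord_flowMap B hS hZ hΦ V
  have hder : ∀ s, HasDerivAt (fun s => s * S (WilsonFlow.coeConfig (Φ s V)))
      (1 * S (WilsonFlow.coeConfig (Φ s V)) + s * D s) s :=
    fun s => (hasDerivAt_id' s).mul (hasDerivAt_comp_flowMap B hS hZt hΦ V s)
  have hi1 : IntervalIntegrable (fun s => 1 * S (WilsonFlow.coeConfig (Φ s V)) + s * D s) volume 0 t :=
    ((continuous_const.mul hcS).add (continuous_id.mul hcD)).intervalIntegrable _ _
  have hi2 : IntervalIntegrable C' volume 0 t := hC'.intervalIntegrable _ _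
  have hFTC : ∫ s in (0 : ℝ)..t, (1 * S (WilsonFlow.coeConfig (Φ s V)) + s * D s) =
      t * S (WilsonFlow.coeConfig (Φ t V)) - 0 * S (WilsonFlow.coeConfig (Φ 0 V)) :=
    intervalIntegral.integral_eq_sub_of_hasDerivAt (fun s _ => hder s) hi1
  have hsplit : ∀ s, linkDiv B (Z s) (WilsonFlow.coeConfig (Φ s V)) =
      (1 * S (WilsonFlow.coeConfig (Φ s V)) + s * D s) + C' s := by
    intro s
    have h := hcrit s (Φ s V)
    rw [hD]
    linarith
  simp_rw [hsplit]
  rw [intervalIntegral.integral_add hi1 hi2, hFTC]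
  ring

omit [NeZero L] in
/-- **Lüscher's trivializing-flow criterion, proved modulo the Jacobian formula (3.9)**: a `C¹` tangent
generator `Z` whose divergence satisfies the linear first-order condition (4.3),
`div Z_t - t (∂S · Z_t) = S + Ċ_t` on `SU(n)^E` with `Ċ` field-independent (continuous), integrates to a flow
`𝓕` whose time-one map is a trivializing map for `S` in the transport sense (2.9):
`(𝓕_1)_* D[V] = 𝒵⁻¹ e^{-S} D[U]`.  Global existence and joint continuity of the flow (§3.1) is the tree theorem
`flowGlobalExistence_holds`; (3.9) is the hypothesis `JacobianFormula d L n`.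
[cite: Luscher2010Trivializing, §4.1 eqs. (4.1)–(4.3), §3.2 eq. (3.9), §2.3 eq. (2.9)] -/
theorem trivializingFlowCriterion_of (hJ : JacobianFormula d L n) : TrivializingFlowCriterion d L n := by
  intro _ B S Z Φ C' hS hZ hZt hΦ hC' hcrit
  haveI : SecondCountableTopology (Matrix (Fin n) (Fin n) ℂ) :=
    inferInstanceAs (SecondCountableTopology (Fin n → Fin n → ℂ))
  haveI : SecondCountableTopology (Matrix.specialUnitaryGroup (Fin n) ℂ) :=
    Topology.IsEmbedding.subtypeVal.secondCountableTopology
  -- the flow map is THE (jointly continuous) global flow, so `Φ 1` is measurable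
  obtain ⟨hΦc, -⟩ := isFlowMap_continuous_unique flowGlobalExistence_holds hZ hZt hΦ
  have hΦ1c : Continuous (Φ 1) := hΦc.comp (continuous_const.prodMk continuous_id)
  have hmeas : Measurable (Φ 1) := hΦ1c.measurable
  have hS'c : Continuous fun U : GaugeConfig d L (Matrix.specialUnitaryGroup (Fin n) ℂ) =>
      S (WilsonFlow.coeConfig U) := hS.continuous.comp WilsonFlow.continuous_coeConfig
  -- the constant `C_1 = ∫₀¹ Ċ`
  set K : ℝ := ∫ s in (0 : ℝ)..1, C' s with hK
  have hlog : ∀ V : GaugeConfig d L (Matrix.specialUnitaryGroup (Fin n) ℂ),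
      ∫ s in (0 : ℝ)..1, linkDiv B (Z s) (WilsonFlow.coeConfig (Φ s V)) =
        S (WilsonFlow.coeConfig (Φ 1 V)) + K := fun V => by
    rw [integral_linkDiv_flowMap_eq B hS hZ hZt hΦ hC' hcrit V 1, one_mul]
  -- (3.9) at `t = 1`, tested against `f · e^{-(S + C_1)}`
  have hhc : Continuous fun U : GaugeConfig d L (Matrix.specialUnitaryGroup (Fin n) ℂ) =>
      Real.exp (-(S (WilsonFlow.coeConfig U) + K)) :=
    Real.continuous_exp.comp (hS'c.add continuous_const).neg
  have key : ∀ f : GaugeConfig d L (Matrix.specialUnitaryGroup (Fin n) ℂ) →ᵇ ℝ,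
      ∫ U, f U * Real.exp (-(S (WilsonFlow.coeConfig U) + K))
          ∂(trivialMeasure (Matrix.specialUnitaryGroup (Fin n) ℂ) d L) =
        ∫ V, f (Φ 1 V) ∂(trivialMeasure (Matrix.specialUnitaryGroup (Fin n) ℂ) d L) := by
    intro f
    have hO : Continuous fun U : GaugeConfig d L (Matrix.specialUnitaryGroup (Fin n) ℂ) =>
        f U * Real.exp (-(S (WilsonFlow.coeConfig U) + K)) := f.continuous.mul hhc
    rw [hJ B Z Φ hZ hZt hΦ 1 _ hO]
    refine integral_congr_ae (Filter.Eventually.of_forall fun V => ?_)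
    simp only [hlog V]
    rw [mul_assoc, ← Real.exp_add, neg_add_cancel, Real.exp_zero, mul_one]
  -- identification of the push-forward and normalisation
  have hmap := map_trivialMeasure_eq_withDensity hmeas hhc (fun U => (Real.exp_pos _).le) key
  rw [withDensity_exp_neg_add_eq_boltzmann hS'c continuous_const] at hmap
  exact ⟨hmeas, map_eq_boltzmann_of_density_le hS'c hmeas hmap fun U U' => le_rfl⟩

end Criterion

end Summit.Ventures.LatticeQCDFlow.TrivializingMaps
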